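import Literature.NumberTheory.LFunctions.MatomakiRadziwillTaoT2OfVK
import Literature.NumberTheory.LFunctions.VinogradovZetaSumEstimate
import HarnessLib

/-!
# Tao 2016, Proposition 2.4, Theorem 2.3, Theorem 1.3 and Corollary 1.5 / Theorem 1.2 proved unconditionally

Topic `Literature/NumberTheory/LFunctions`.  Everything in this file is PROVED (four one-line discharges); no
definitions, no named facts.

T. Tao, *The logarithmically averaged Chowla and Elliott conjectures for two-point correlations*, Forum Math.
Pi **4** (2016), e8 = arXiv:1509.05422.  The tree vendors four statements of the paper as named facts —
`Tao2016_prop24` (Proposition 2.4, `TaoLogElliottTheorem23.lean`), `Tao2016_theorem23` (Theorem 2.3,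
`TaoLogElliottReduction.lean`), `tao_log_averaged_elliott_two` (**Theorem 1.3**, the logarithmically averaged
nonasymptotic Elliott conjecture for two-point correlations; parity.S24, `MultiplicativeCorrelations.lean`) and
`tao_log_chowla_two` (Theorem 1.2 / Corollary 1.5 for `λ` and every shift `h ≠ 0`, ibid.) — and proves each
of them from ANY Vinogradov–Korobov zero-free region for Dirichlet `L`-functions
(`MatomakiRadziwillTaoT2OfVK.lean`: `MRT2015.Tao2016_prop24_of_vk`, `MRT2015.Tao2016_theorem23_of_vk`,
`MRT2015.tao_log_averaged_elliott_two_of_vk`, `MRT2015.tao_log_chowla_two_of_vk`, with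
`(hcVK : 0 < cVK) (hVK : HasVKZeroFreeRegion cVK TVK)`).  Independently the tree proves such a region
unconditionally (`VKZeta.exists_hasVKZeroFreeRegion : ∃ c > 0, HasVKZeroFreeRegion c 21`,
`VinogradovZetaSumEstimate.lean`, from Vinogradov's mean value theorem `vmvtBound_thirtyTwo` through Ivić's
Theorem 6.2, Ford's shape of the exponential-sum bound and Richert-type bounds).  Neither module imports the
other; this file joins them:

* `Tao2016_prop24_holds` — Proposition 2.4 ((2.10): `sup_α ∑_{x/ω<n≤x} |∑_{j≤H} g₁(n+j)e(jα)|/(Hn) ≪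
  (log log H/log H) log ω`), along the printed line "from Matomäki–Radziwiłł–Tao 2015 with `W = log⁵ H`":
  Proposition A.3 in the restricted-Halász form with middle term `K (1 + M) e^{-M/2}`
  (`MRT2015.propA3With_exp_half_of_vk`) → Theorem A.2 → the major arcs → Theorem 1.7 (saving `e^{-M/120}`)
  → (2.10);
* `Tao2016_theorem23_holds` — Theorem 2.3, from Proposition 2.4 and the proved core of its proof (Lemma 2.5,
  Proposition 2.6, §3: entropy decrement, Hoeffding, circle method, restriction theorem for the primes;
  `Tao2016.Tao2016_theorem23_core_holds`, `TaoLogElliottCore.lean`);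
* `tao_log_averaged_elliott_two_holds` — **Theorem 1.3**, from Theorem 2.3 by the §2 reductions
  (Propositions 2.1–2.2 and the two paragraphs before Theorem 2.3; `Tao2016_section2_reduction_holds`);
* `tao_log_chowla_two_holds` — Theorem 1.2 (`ω(x) = x`) for `λ(n)λ(n+h)`, `h ≠ 0`, from Theorem 1.3
  (`tao_log_chowla_two_of_elliott_two`: Corollary 1.5 with `λ` non-pretentious,
  `Tao2016_liouvilleNonpretentious_holds`).

The companions `Sieve.tao_log_chowla_liouville_holds`, `Sieve.tao_log_chowla_moebius_holds` (parity.S21) live in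
`Literature/NumberTheory/Sieve/ParityWave0LogChowla{Liouville,Moebius}Holds.lean`.  Axiom closure of every
theorem below: `propext`, `Classical.choice`, `Quot.sound`.  NOT discharged here (different constants from what
the tree proves): `MatomakiRadziwillTao2015_theorem17` (printed saving `e^{-M/20}`; the tree has `e^{-M/120}`),
`MatomakiRadziwillTao2015_theoremA2` / `_propA3` as printed (middle term `(1+M)e^{-M}`; the tree has
`(1+M)e^{-M/2}`), and Khale's explicit region `Khale2024_zeroFreeRegion`.

## References

* T. Tao, Forum Math. Pi 4 (2016), e8, doi:10.1017/fmp.2016.6 = arXiv:1509.05422: Theorem 1.2, Theorem 1.3,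
  Corollary 1.5, §1 (paragraph after Remark 1.6), §2 (Propositions 2.1–2.2, Theorem 2.3, Proposition 2.4,
  Lemma 2.5, Proposition 2.6), §3 (Lemmas 3.2–3.7). [TaoFMP2016]
* K. Matomäki, M. Radziwiłł, T. Tao, Algebra & Number Theory 9 (2015), 2167–2196: Theorem 1.7, Appendix A
  (Theorem A.2, Proposition A.3, Lemma A.4). [MatomakiRadziwillTao2015]
* K. Matomäki, M. Radziwiłł, Ann. of Math. 183 (2016), Proposition 1, Lemma 11. [MatomakiRadziwillAnnals2016]
* A. Ivić, *The Riemann zeta-function* (1985), Theorems 6.1–6.2, Lemma 6.3. [Ivic1985]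
-/

namespace Literature.NumberTheory.LFunctions

/-- **Tao 2016, Proposition 2.4, PROVED** (the named fact `Tao2016_prop24` discharged): the
Vinogradov–Korobov region `VKZeta.exists_hasVKZeroFreeRegion` fed into `MRT2015.Tao2016_prop24_of_vk`
(Matomäki–Radziwiłł–Tao 2015, Proposition A.3 / Theorem A.2 / Theorem 1.7 with `W = log⁵ H`).
[cite: TaoFMP2016, Proposition 2.4] -/
theorem Tao2016_prop24_holds : Tao2016_prop24 := by
  obtain ⟨c, hc, hVK⟩ := VKZeta.exists_hasVKZeroFreeRegion
  exact MRT2015.Tao2016_prop24_of_vk hc hVK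

/-- **Tao 2016, Theorem 2.3, PROVED** (the named fact `Tao2016_theorem23` discharged): Proposition 2.4
(`Tao2016_prop24_holds`) and the proved core of the printed proof — Lemma 2.5, Proposition 2.6 and §3
(`Tao2016.Tao2016_theorem23_core_holds`) — via `Tao2016_theorem23_of_prop24`.
[cite: TaoFMP2016, Theorem 2.3] -/
theorem Tao2016_theorem23_holds : Tao2016_theorem23 :=
  Tao2016_theorem23_of_prop24 Tao2016_prop24_holds

/-- **Tao 2016, Theorem 1.3 (logarithmically averaged nonasymptotic Elliott conjecture for two-point
correlations), PROVED** (the named fact `tao_log_averaged_elliott_two`, parity.S24, discharged): Theorem 2.3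
(`Tao2016_theorem23_holds`) and the §2 reductions (`Tao2016_section2_reduction_holds`), via
`tao_log_averaged_elliott_two_of_prop24`. [cite: TaoFMP2016, Theorem 1.3] -/
theorem tao_log_averaged_elliott_two_holds : tao_log_averaged_elliott_two :=
  tao_log_averaged_elliott_two_of_prop24 Tao2016_prop24_holds

/-- **Tao 2016, Theorem 1.2 with `ω(x) = x` for `λ(n)λ(n+h)`, every `h ≠ 0`, PROVED** (the named fact
`tao_log_chowla_two` discharged): Theorem 1.3 (`tao_log_averaged_elliott_two_holds`) applied to the
non-pretentious `λ` (`tao_log_chowla_two_of_elliott_two`). [cite: TaoFMP2016, Theorem 1.2 and Corollary 1.5] -/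
theorem tao_log_chowla_two_holds : tao_log_chowla_two :=
  tao_log_chowla_two_of_elliott_two tao_log_averaged_elliott_two_holds

end Literature.NumberTheory.LFunctions
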